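import Summits.ResolutionOfSingularities.ResolutionOfSingularities.Theorems.RisoStrataRisoCurvesLoc
import Summits.ResolutionOfSingularities.ResolutionOfSingularities.Theorems.RisoStrataRisoCentresResolvePlumbing
import Literature.AlgebraicGeometry.Resolution.QuadraticSequenceDimOneExistence
import Literature.AlgebraicGeometry.Resolution.NormalizationOfVarietiesProofs

/-!
# Route RisoStrata — crux `RisoCentresResolve` (stmt-ResolutionOfSingularities-18546), line `Sketch` v4:
# termination of the curve case (`stub_rcrCurveReach`)

Let `k ⊆ K` be fields, `B ⊆ K` a finitely generated `k`-subalgebra of Krull dimension `≤ 1` with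
`Frac B = K`, and `O ⊊ K` a valuation ring of `K` containing `B`. We prove
(`stub_rcrCurveReach`): `O` is a discrete valuation ring, and EVERY sequence
`A 0 = B_{𝔪_O ∩ B} → A 1 → A 2 → ⋯` of quadratic transforms along `O` (Herrmann–Ikeda–Orbanz,
Ch. VI, (30.2)) reaches `O`: `A c = O` for some `c`.

Proof (assembling results PROVED in the tree):
* `B` is not a field and the centre of `O` on any subring `R ⊆ O` with `Frac R = K` is nonzero
  (otherwise every nonzero `b ∈ R` would be a unit of `O`, forcing `O = K`);
* the normalization `N = integralClosure B K` is a finite `B`-module (E. Noether,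
  `NoetherFiniteIntegralClosure_holds`) and a Dedekind domain (Krull–Akizuki,
  `KrullAkizuki_holds.isDedekindDomain_integralClosure`), and `N ⊆ O` since `O` is integrally
  closed in `K`;
* `V = N_{𝔪_O ∩ N}` (`locAtCentre`) is the localization of a Dedekind domain at a nonzero prime,
  a discrete valuation ring contained in `O`, hence `O = V` (`toSubring_eq_of_dvr_subring`: a DVR
  is a maximal proper subring among valuation rings) and `O` is a DVR;
* with `S` a finite set of `B`-module generators of `N` we have `N ⊆ (A 0)[S]` and
  `O ⊆ N_{𝔪_O ∩ N}`, exactly the hypotheses of Herrmann–Ikeda–Orbanz (30.2)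
  (`exists_sequence_eq_valuationSubring`), applied to the local ring `A 0 = B_{𝔪_O ∩ B}`, which is
  Noetherian of dimension `≤ 1` as a localization of `B`.
-/

noncomputable section

set_option linter.dupNamespace false -- mandated namespace of this single-conjunct summit

namespace Summit.ResolutionOfSingularities.ResolutionOfSingularities.Theorems

open Literature.AlgebraicGeometry.Resolution IsLocalRing
open Literature.RingTheory.DiscreteValuationRing

section Helpers

variable {K : Type} [Field K]

/-- If `R ⊆ O ⊊ K` and every element of `K` is a fraction of elements of `R`, then some nonzero
`b ∈ R` is not a unit of `O`. [folklore] -/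
private theorem exists_ne_zero_inv_not_mem (R : Subring K)
    (hfrac : ∀ z : K, ∃ a ∈ R, ∃ b ∈ R, b ≠ 0 ∧ z = a / b)
    (O : ValuationSubring K) (hRO : R ≤ O.toSubring) (hO : O ≠ ⊤) :
    ∃ b ∈ R, b ≠ 0 ∧ b⁻¹ ∉ O := by
  by_contra h
  push Not at h
  apply hO
  rw [eq_top_iff]
  intro z _
  obtain ⟨a, ha, b, hb, hb0, rfl⟩ := hfrac z
  rw [div_eq_mul_inv]
  exact O.mul_mem _ _ (hRO ha) (h b hb hb0)

/-- Under the same hypotheses the centre `𝔪_O ∩ R` of `O` on `R` is nonzero. [folklore] -/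
private theorem subringCentre_ne_bot_of_ne_top (R : Subring K)
    (hfrac : ∀ z : K, ∃ a ∈ R, ∃ b ∈ R, b ≠ 0 ∧ z = a / b)
    (O : ValuationSubring K) (hRO : R ≤ O.toSubring) (hO : O ≠ ⊤) :
    subringCentre R O hRO ≠ ⊥ := by
  obtain ⟨b, hb, hb0, hbi⟩ := exists_ne_zero_inv_not_mem R hfrac O hRO hO
  intro hbot
  by_cases hmem : (⟨b, hb⟩ : R) ∈ subringCentre R O hRO
  · rw [hbot, Ideal.mem_bot] at hmem
    exact hb0 (congrArg Subtype.val hmem)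
  · have hv : O.valuation b = 1 := valuation_eq_one_of_not_mem_subringCentre hRO hmem
    exact hbi ((O.valuation_le_one_iff _).mp (by rw [map_inv₀, hv, inv_one]))

variable {k : Type} [Field k] [Algebra k K]

/-- A subalgebra `B ⊆ O ⊊ K` with `Frac B = K` is not a field. [folklore] -/
private theorem not_isField_of_le_of_ne_top (B : Subalgebra k K)
    (hfrac : ∀ z : K, ∃ a ∈ B, ∃ b ∈ B, b ≠ 0 ∧ z = a / b)
    (O : ValuationSubring K) (hBO : B.toSubring ≤ O.toSubring) (hO : O ≠ ⊤) : ¬ IsField ↥B := by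
  obtain ⟨b, hb, hb0, hbi⟩ := exists_ne_zero_inv_not_mem B.toSubring hfrac O hBO hO
  intro hF
  obtain ⟨c, hc⟩ := hF.mul_inv_cancel (a := ⟨b, hb⟩) (fun h => hb0 (congrArg Subtype.val h))
  apply hbi
  have hbc : b * (c : K) = 1 := congrArg Subtype.val hc
  rw [inv_eq_of_mul_eq_one_right hbc]
  exact hBO c.2

/-- The normalization of `B` lies in every valuation ring `O ⊇ B` of `K` (`O` is integrally
closed in `K`). [folklore] -/
private theorem integralClosure_le_valuationSubring (B : Subalgebra k K) (O : ValuationSubring K)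
    (hBO : B.toSubring ≤ O.toSubring) :
    (integralClosure ↥B K).toSubring ≤ O.toSubring := by
  intro x hx
  have hx' : IsIntegral ↥B x := hx
  let φ : ↥B →+* ↥O :=
    { toFun := fun b => ⟨b, hBO b.2⟩
      map_one' := rfl
      map_mul' := fun _ _ => rfl
      map_zero' := rfl
      map_add' := fun _ _ => rfl }
  have hxO : IsIntegral ↥O x :=
    hx'.map_of_comp_eq φ (RingHom.id K) (RingHom.ext fun _ => rfl)
  obtain ⟨y, hy⟩ := IsIntegrallyClosed.algebraMap_eq_of_integral hxO
  have : x = (y : K) := hy.symm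
  rw [this]
  exact y.2

end Helpers

/-- **Stub (curves, termination).** For a finitely generated one-dimensional `k`-subalgebra
`B ⊆ O` of `K` with `Frac B = K` and a non-trivial valuation ring `O`, every sequence of
quadratic transforms along `O` starting at `B_{𝔪_O ∩ B}` reaches `O`, which is a discrete
valuation ring (E. Noether finiteness + Krull–Akizuki + Herrmann–Ikeda–Orbanz (30.2)). -/
theorem stub_rcrCurveReach {k K : Type} [Field k] [Field K] [Algebra k K]
    (B : Subalgebra k K) (hB : B.FG) (hfrac : ∀ z : K, ∃ a ∈ B, ∃ b ∈ B, b ≠ 0 ∧ z = a / b)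
    (hdim : ringKrullDim ↥B ≤ 1)
    (O : ValuationSubring K) (hBO : B.toSubring ≤ O.toSubring) (hO : O ≠ ⊤)
    (A : ℕ → Subring K) (hA0 : A 0 = locAtCentre B.toSubring O)
    (hstep : ∀ i, IsQuadraticTransformAlong O (A i) (A (i + 1))) :
    IsDiscreteValuationRing ↥O ∧ ∃ c, A c = O.toSubring := by
  classical
  -- (1) `B` is a Noetherian domain of dimension `≤ 1`, of finite type over `k`, with `Frac B = K`
  haveI hBnoeth : IsNoetherianRing ↥B := isNoetherianRing_of_fg hB
  haveI : Algebra.FiniteType k ↥B := (Subalgebra.fg_iff_finiteType B).mp hB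
  haveI : Ring.KrullDimLE 1 ↥B := Ring.krullDimLE_iff.mpr hdim
  haveI hBdim : Ring.DimensionLEOne ↥B :=
    ⟨fun h1 h2 => Ring.krullDimLE_one_iff_of_isPrime_bot.mp inferInstance _ h1 h2⟩
  haveI : FaithfulSMul ↥B K :=
    (faithfulSMul_iff_algebraMap_injective ↥B K).mpr Subtype.val_injective
  haveI : IsFractionRing ↥B K := IsFractionRing.of_field ↥B K fun z => by
    obtain ⟨a, ha, b, hb, -, rfl⟩ := hfrac z
    exact ⟨⟨a, ha⟩, ⟨b, hb⟩, rfl⟩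
  -- (2) `B` is not a field (`O ≠ K`)
  have hnf : ¬ IsField ↥B := not_isField_of_le_of_ne_top B hfrac O hBO hO
  -- (3) the normalization `N` is finite over `B` (E. Noether) and Dedekind (Krull–Akizuki)
  haveI hfin : Module.Finite ↥B ↥(integralClosure ↥B K) :=
    NoetherFiniteIntegralClosure_holds k ↥B K K
  haveI hDed : IsDedekindDomain ↥(integralClosure ↥B K) :=
    KrullAkizuki_holds.isDedekindDomain_integralClosure hnf K K
  set NK : Subring K := (integralClosure ↥B K).toSubring with hNK
  haveI : IsDedekindDomain ↥NK := hDed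
  have hBN : B.toSubring ≤ NK := fun x hx =>
    show IsIntegral ↥B x from isIntegral_algebraMap (R := ↥B) (A := K) (x := ⟨x, hx⟩)
  -- (4) `N ⊆ O`
  have hNO : NK ≤ O.toSubring := integralClosure_le_valuationSubring B O hBO
  -- (5) the centre of `O` on `N` is a nonzero prime, so `V = N_{𝔪_O ∩ N}` is a DVR
  have hfracN : ∀ z : K, ∃ a ∈ NK, ∃ b ∈ NK, b ≠ 0 ∧ z = a / b := fun z => by
    obtain ⟨a, ha, b, hb, hb0, rfl⟩ := hfrac z
    exact ⟨a, hBN ha, b, hBN hb, hb0, rfl⟩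
  have hn : subringCentre NK O hNO ≠ ⊥ := subringCentre_ne_bot_of_ne_top NK hfracN O hNO hO
  haveI := isLocalization_locAtCentre hNO
  haveI : IsDiscreteValuationRing ↥(locAtCentre NK O) :=
    IsLocalization.AtPrime.isDiscreteValuationRing_of_dedekind_domain ↥NK hn (locAtCentre NK O)
  -- (6) `O = V`, so `O` is a DVR
  have hfracV : ∀ z : K, ∃ a ∈ locAtCentre NK O, ∃ b ∈ locAtCentre NK O, b ≠ 0 ∧ z = a / b :=
    fun z => by
    obtain ⟨a, ha, b, hb, hb0, rfl⟩ := hfracN z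
    exact ⟨a, le_locAtCentre NK O ha, b, le_locAtCentre NK O hb, hb0, rfl⟩
  have hOV : O.toSubring = locAtCentre NK O :=
    toSubring_eq_of_dvr_subring (locAtCentre NK O) hfracV O (locAtCentre_le hNO) hO
  have hdvr : IsDiscreteValuationRing ↥O :=
    IsDiscreteValuationRing.RingEquivClass.isDiscreteValuationRing
      (A := ↥(locAtCentre NK O)) (B := ↥O)
      ({ toFun := fun x => ⟨x.1, locAtCentre_le hNO x.2⟩, invFun := fun x => ⟨x.1, hOV.le x.2⟩,
         left_inv := fun _ => rfl, right_inv := fun _ => rfl, map_mul' := fun _ _ => rfl,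
         map_add' := fun _ _ => rfl } : ↥(locAtCentre NK O) ≃+* ↥O)
  -- (7) generators of `N` over `B`, and `N ⊆ (A 0)[S]`
  obtain ⟨s, hs⟩ := Module.Finite.fg_top (R := ↥B) (M := ↥(integralClosure ↥B K))
  have hBL : B.toSubring ≤ A 0 := by
    rw [hA0]
    exact le_locAtCentre _ O
  have hSN : (↑(s.image fun c : ↥(integralClosure ↥B K) => (c : K)) : Set K) ⊆ NK := by
    intro x hx
    rw [Finset.coe_image] at hx
    obtain ⟨c, -, rfl⟩ := hx
    exact c.2
  have hNS : NK ≤ Subring.closure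
      ((A 0 : Set K) ∪ ↑(s.image fun c : ↥(integralClosure ↥B K) => (c : K))) := by
    have key : ∀ x ∈ Submodule.span ↥B (s : Set ↥(integralClosure ↥B K)),
        (x : K) ∈ Subring.closure
          ((A 0 : Set K) ∪ ↑(s.image fun c : ↥(integralClosure ↥B K) => (c : K))) := by
      intro x hx
      induction hx using Submodule.span_induction with
      | mem x hx =>
        refine Subring.subset_closure (Or.inr ?_)
        rw [Finset.coe_image]
        exact ⟨x, hx, rfl⟩
      | zero => exact Subring.zero_mem _
      | add x y _ _ hx hy => exact Subring.add_mem _ hx hy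
      | smul a x _ hx =>
        change ((a : K) * (x : K)) ∈ _
        exact Subring.mul_mem _ (Subring.subset_closure (Or.inl (hBL a.2))) hx
    intro c hc
    have hcmem : (⟨c, hc⟩ : ↥(integralClosure ↥B K)) ∈
        Submodule.span ↥B (s : Set ↥(integralClosure ↥B K)) := by
      rw [hs]; exact Submodule.mem_top
    exact key _ hcmem
  -- (8) `A 0 = B_{𝔪_O ∩ B}` is a one-dimensional Noetherian local domain dominated by `O`
  haveI := isLocalization_locAtCentre hBO
  haveI : IsNoetherianRing ↥(A 0) := by
    rw [hA0]
    exact IsLocalization.isNoetherianRing (subringCentre B.toSubring O hBO).primeCompl _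
      (show IsNoetherianRing ↥B.toSubring from hBnoeth)
  haveI : Ring.KrullDimLE 1 ↥(A 0) := by
    rw [hA0]
    haveI : Ring.DimensionLEOne ↥B.toSubring := hBdim
    haveI : Ring.DimensionLEOne ↥(locAtCentre B.toSubring O) :=
      Ring.DimensionLEOne.localization (locAtCentre B.toSubring O)
        (M := (subringCentre B.toSubring O hBO).primeCompl) (Ideal.primeCompl_le_nonZeroDivisors _)
    infer_instance
  have hof : IsLocalRingOf (A 0) := by
    rw [hA0]
    refine ⟨isLocalRing_locAtCentre hBO, fun z => ?_⟩
    obtain ⟨a, ha, b, hb, hb0, rfl⟩ := hfrac z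
    exact ⟨a, le_locAtCentre _ O ha, b, le_locAtCentre _ O hb, hb0, rfl⟩
  have h0 : SubringDominates (A 0) O.toSubring := by
    rw [hA0]
    exact subringDominates_locAtCentre hBO
  exact ⟨hdvr, exists_sequence_eq_valuationSubring (A := A) hof h0 hstep hNO _ hSN hNS hOV.le⟩

end Summit.ResolutionOfSingularities.ResolutionOfSingularities.Theorems

end
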